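import Summits.RiemannHypothesis.RiemannHypothesis.Theorems.HandoffDecomposition
import Summits.RiemannHypothesis.RiemannHypothesis.Theorems.HandoffCross
import Summits.RiemannHypothesis.RiemannHypothesis.Theorems.HandoffAnalytic
import HarnessLib

/-!
# HANDOFF — MIRROR POLARIZATION: the new prime pays for mirror-symmetry and rewards mirror-antisymmetry about its entrance point, by parity (cell rh-explicit, TRACK «HANDOFF», seat theory-2 gen7, file XII-q; sequel of XII-p `HandoffEntranceSignLayer`)

HONEST FRAMING. Nothing here bears on the truth of RH; everything is RH-free and elementary. XII-p showed that the contribution of a prime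
`q` (`L = log q`) to Weil's form at a test function `g` on `[−b, b]`, `L/2 < b ≤ (log q⁺)/2`, is the layer integral
`−(2 log q/√q)·Re ∫ g(u)·conj g(u − L) du`, and drew SIGN consequences for edge-single-signed functions. The DERIVED-CHECK that followed
(HOME/handoff/theory-2/edgesign/REPORT.md; scored by cc-s2-5 on 171 certified kinked section bottoms) found a sharper regularity: the even
negative witnesses of the deleted form carry ONE node in the layer, sitting at the entrance point `(log q)/2` (at `+δ/4` at the wall), the odd
ones none. This file types the identity behind it. Let `σ_L u := L − u` (the MIRROR about the entrance point `L/2`; it maps the layer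
`[L − b, b]` onto itself). By polarization (`Re⟨a, b⟩ = ¼(‖a + b‖² − ‖a − b‖²)`, no realness needed):
* EVEN `g` (`g(−t) = g(t)`, so `g(u − L) = g(σ_L u)`):
  **`contribution_q(g) = (log q/(2√q))·(‖g − g∘σ_L‖₂² − ‖g + g∘σ_L‖₂²)`** (`contribution_even_eq_mirror`) — the prime REWARDS the
  mirror-ANTISYMMETRIC part of an even function about `(log q)/2` and CHARGES the mirror-symmetric part, at the rate `cap(q)/2` each;
* ODD `g` (`g(u − L) = −g(σ_L u)`): **`contribution_q(g) = (log q/(2√q))·(‖g + g∘σ_L‖₂² − ‖g − g∘σ_L‖₂²)`** (`contribution_odd_eq_mirror`) — the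
  opposite bookkeeping.
Consequences: §3 two-sided bounds `−(cap/2)‖g + g∘σ_L‖² ≤ contribution_q(g) ≤ (cap/2)‖g − g∘σ_L‖²` (even) and the swapped ones (odd) — all
norms plain `∫‖·‖²` over `ℝ` (the cross terms only see the layer `[L − b, b]`, `contribution_eq_layer`); §4 THE LAYER FORM
(`tsupport g ⊆ [−b, b]`, hypotheses on the layer `[log q − b, b]` only): an EVEN `g` whose layer profile is mirror-SYMMETRIC about `(log q)/2`
(`g(log q − u) = g(u)` there; e.g. XII-k's even Cramér pair) is CHARGED in full, `contribution_q = −(2 log q/√q)·∫_{layer}‖g‖²`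
(`contribution_even_of_mirror_symmetric_layer`); an EVEN `g` whose layer profile is mirror-ANTISYMMETRIC (a node AT the entrance point, odd local
profile) is REWARDED in full, `+(2 log q/√q)·∫_{layer}‖g‖²` (`…_antisymmetric_layer`) — the extremal shape behind the node law; for ODD `g` the
roles swap (`contribution_odd_of_mirror_symmetric_layer`: single-signed, mirror-symmetric layer profile = full rescue — the shape of the certified
odd wall vectors; `…_antisymmetric_layer`: full charge) — the kernel face of «odd carries the wall, even carries the margin».
References: A. Connes, C. Consani, Enseign. Math. 69 (2023) §2.2–§2.3 (`ConnesConsani2023`); E. Bombieri, Rend. Mat. Acc. Lincei (9) 11 (2000) §2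
(`Bombieri2000Weil`: parity). The identities are this track's bookkeeping.
-/

set_option linter.dupNamespace false  -- the mandated namespace repeats `RiemannHypothesis`

noncomputable section

open Complex Set MeasureTheory Literature.NumberTheory.LFunctions
open Summit.RiemannHypothesis.RiemannHypothesis.Theorems.Handoff
open Summit.RiemannHypothesis.RiemannHypothesis.Theorems.HandoffDecomposition (contribution_eq_two_mul)
open scoped ComplexConjugate

namespace Summit.RiemannHypothesis.RiemannHypothesis.Theorems.HandoffMirrorPolarization

variable {g : ℝ → ℂ} {q : ℕ} {L : ℝ}

/-! ## §1 Polarization for the shifted autocorrelation -/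

/-- The mirror copy `u ↦ g(L − u)` is a Weil test function. [folklore] -/
theorem isWeilTest_mirror (hg : IsWeilTest g) (L : ℝ) : IsWeilTest fun u ↦ g (L - u) := by
  have h := hg.comp_neg
  have e : (fun u : ℝ ↦ g (L - u)) = fun u ↦ (fun t ↦ g (-t)) (u - L) := by funext u; simp [neg_sub]
  rw [e]
  exact ⟨h.1.comp (contDiff_id.sub contDiff_const), h.2.comp_homeomorph (Homeomorph.subRight L)⟩

/-- **Polarization**: `Re ∫ g·conj h = ¼(∫‖g + h‖² − ∫‖g − h‖²)` for test functions `g, h`. [folklore] -/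
theorem re_integral_mul_conj_eq_polar {h : ℝ → ℂ} (hg : IsWeilTest g) (hh : IsWeilTest h) :
    (∫ u : ℝ, g u * conj (h u)).re =
      ((∫ u : ℝ, ‖g u + h u‖ ^ 2) - ∫ u : ℝ, ‖g u - h u‖ ^ 2) / 4 := by
  have hpt : ∀ u : ℝ, ‖g u + h u‖ ^ 2 - ‖g u - h u‖ ^ 2 = 4 * (g u * conj (h u)).re := by
    intro u
    rw [← Complex.normSq_eq_norm_sq, ← Complex.normSq_eq_norm_sq, Complex.normSq_add, Complex.normSq_sub]
    simp only [Complex.mul_re, Complex.conj_re, Complex.conj_im]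
    ring
  have hig : Integrable (fun u : ℝ ↦ ‖g u + h u‖ ^ 2) := by
    have hs : HasCompactSupport ((fun z : ℂ ↦ ‖z‖ ^ 2) ∘ (g + h)) := (hg.2.add hh.2).comp_left (by simp)
    exact Continuous.integrable_of_hasCompactSupport ((hg.1.continuous.add hh.1.continuous).norm.pow 2)
      (by simpa [Function.comp_def] using hs)
  have hid : Integrable (fun u : ℝ ↦ ‖g u - h u‖ ^ 2) := by
    have hs : HasCompactSupport ((fun z : ℂ ↦ ‖z‖ ^ 2) ∘ (g - h)) := (hg.2.sub hh.2).comp_left (by simp)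
    exact Continuous.integrable_of_hasCompactSupport ((hg.1.continuous.sub hh.1.continuous).norm.pow 2)
      (by simpa [Function.comp_def] using hs)
  have hprod : Integrable (fun u : ℝ ↦ g u * conj (h u)) :=
    Continuous.integrable_of_hasCompactSupport (hg.1.continuous.mul (Complex.continuous_conj.comp hh.1.continuous)) hg.2.mul_right
  have hre := integral_re hprod
  rw [RCLike.re_eq_complex_re] at hre
  rw [← hre, ← integral_sub hig hid]
  simp_rw [hpt]
  rw [integral_const_mul]
  ring

/-! ## §2 The mirror identities -/

/-- **EVEN: `contribution_q(g) = (log q/(2√q))·(‖g − g∘σ_L‖² − ‖g + g∘σ_L‖²)`**, `σ_L u = log q − u`: the prime rewards the mirror-antisymmetric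
part about its entrance point and charges the mirror-symmetric part. [this track] -/
theorem contribution_even_eq_mirror (hg : IsWeilTest g) (hev : ∀ t, g (-t) = g t) :
    contribution q g = Real.log q / (2 * Real.sqrt q) *
      ((∫ u : ℝ, ‖g u - g (Real.log q - u)‖ ^ 2) - ∫ u : ℝ, ‖g u + g (Real.log q - u)‖ ^ 2) := by
  have e : (fun u : ℝ ↦ g u * conj (g (u - Real.log q))) = fun u ↦ g u * conj (g (Real.log q - u)) := by
    funext u; rw [← hev (u - Real.log q), neg_sub]
  rw [contribution_eq_two_mul, weilConv_weilReflect_eq_integral, e, re_integral_mul_conj_eq_polar hg (isWeilTest_mirror hg _)]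
  ring

/-- **ODD: `contribution_q(g) = (log q/(2√q))·(‖g + g∘σ_L‖² − ‖g − g∘σ_L‖²)`**: the opposite bookkeeping — the prime rewards the
mirror-symmetric part of an odd function about `(log q)/2`. [this track] -/
theorem contribution_odd_eq_mirror (hg : IsWeilTest g) (hodd : ∀ t, g (-t) = -g t) :
    contribution q g = Real.log q / (2 * Real.sqrt q) *
      ((∫ u : ℝ, ‖g u + g (Real.log q - u)‖ ^ 2) - ∫ u : ℝ, ‖g u - g (Real.log q - u)‖ ^ 2) := by
  have e : (fun u : ℝ ↦ g u * conj (g (u - Real.log q))) = fun u ↦ -(g u * conj (g (Real.log q - u))) := by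
    funext u; rw [← neg_sub (Real.log q) u, hodd (Real.log q - u), map_neg, mul_neg]
  rw [contribution_eq_two_mul, weilConv_weilReflect_eq_integral, e, integral_neg, Complex.neg_re,
    re_integral_mul_conj_eq_polar hg (isWeilTest_mirror hg _)]
  ring

/-! ## §3 Consequences: what the prime charges and what it rewards -/

/-- The weight `log q/(2√q) ≥ 0`. [folklore] -/
theorem log_div_two_sqrt_nonneg (q : ℕ) : 0 ≤ Real.log q / (2 * Real.sqrt q) :=
  div_nonneg (Real.log_natCast_nonneg q) (mul_nonneg zero_le_two (Real.sqrt_nonneg _))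

/-- EVEN, upper: `contribution_q(g) ≤ (log q/(2√q))·‖g − g∘σ_L‖²` — only the mirror-antisymmetric part can be rewarded. [this track] -/
theorem contribution_even_le (hg : IsWeilTest g) (hev : ∀ t, g (-t) = g t) :
    contribution q g ≤ Real.log q / (2 * Real.sqrt q) * ∫ u : ℝ, ‖g u - g (Real.log q - u)‖ ^ 2 := by
  rw [contribution_even_eq_mirror hg hev, mul_sub]
  have h0 : 0 ≤ ∫ u : ℝ, ‖g u + g (Real.log q - u)‖ ^ 2 := integral_nonneg fun u ↦ by positivity
  nlinarith [log_div_two_sqrt_nonneg q]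

/-- EVEN, lower: `−(log q/(2√q))·‖g + g∘σ_L‖² ≤ contribution_q(g)` — only the mirror-symmetric part is charged. [this track] -/
theorem contribution_even_ge (hg : IsWeilTest g) (hev : ∀ t, g (-t) = g t) :
    -(Real.log q / (2 * Real.sqrt q) * ∫ u : ℝ, ‖g u + g (Real.log q - u)‖ ^ 2) ≤ contribution q g := by
  rw [contribution_even_eq_mirror hg hev, mul_sub]
  have h0 : 0 ≤ ∫ u : ℝ, ‖g u - g (Real.log q - u)‖ ^ 2 := integral_nonneg fun u ↦ by positivity
  nlinarith [log_div_two_sqrt_nonneg q]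

/-- ODD, upper: `contribution_q(g) ≤ (log q/(2√q))·‖g + g∘σ_L‖²` — an odd function is rewarded only through its mirror-SYMMETRIC part about
`(log q)/2` (no node needed: «odd carries the wall»). [this track] -/
theorem contribution_odd_le (hg : IsWeilTest g) (hodd : ∀ t, g (-t) = -g t) :
    contribution q g ≤ Real.log q / (2 * Real.sqrt q) * ∫ u : ℝ, ‖g u + g (Real.log q - u)‖ ^ 2 := by
  rw [contribution_odd_eq_mirror hg hodd, mul_sub]
  have h0 : 0 ≤ ∫ u : ℝ, ‖g u - g (Real.log q - u)‖ ^ 2 := integral_nonneg fun u ↦ by positivity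
  nlinarith [log_div_two_sqrt_nonneg q]

/-- ODD, lower: `−(log q/(2√q))·‖g − g∘σ_L‖² ≤ contribution_q(g)`. [this track] -/
theorem contribution_odd_ge (hg : IsWeilTest g) (hodd : ∀ t, g (-t) = -g t) :
    -(Real.log q / (2 * Real.sqrt q) * ∫ u : ℝ, ‖g u - g (Real.log q - u)‖ ^ 2) ≤ contribution q g := by
  rw [contribution_odd_eq_mirror hg hodd, mul_sub]
  have h0 : 0 ≤ ∫ u : ℝ, ‖g u + g (Real.log q - u)‖ ^ 2 := integral_nonneg fun u ↦ by positivity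
  nlinarith [log_div_two_sqrt_nonneg q]

/-! ## §4 The layer form: what a mirror-symmetric or mirror-antisymmetric LAYER PROFILE earns -/

variable {b : ℝ}

/-- The shifted autocorrelation integrand lives on the layer: for `tsupport g ⊆ [−b, b]`,
`∫ g(u)·conj g(u − L) du = ∫_{[L − b, b]} g(u)·conj g(u − L) du`. [folklore] -/
theorem integral_mul_conj_shift_eq_setIntegral (hsupp : tsupport g ⊆ Icc (-b) b) (L : ℝ) :
    ∫ u : ℝ, g u * conj (g (u - L)) = ∫ u in Icc (L - b) b, g u * conj (g (u - L)) := by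
  refine (setIntegral_eq_integral_of_forall_compl_eq_zero fun u hu ↦ ?_).symm
  simp only [mem_Icc, not_and_or, not_le] at hu
  rcases hu with h | h
  · have : g (u - L) = 0 := image_eq_zero_of_notMem_tsupport fun hm ↦ by have := (hsupp hm).1; linarith
    rw [this, map_zero, mul_zero]
  · have : g u = 0 := image_eq_zero_of_notMem_tsupport fun hm ↦ by have := (hsupp hm).2; linarith
    rw [this, zero_mul]

/-- **The contribution as a LAYER integral**: `contribution_q(g) = −(2 log q/√q)·Re ∫_{[log q − b, b]} g(u)·conj g(u − log q) du` for `g` on `[−b, b]`.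
[cite: ConnesConsani2023, §2.2–§2.3] -/
theorem contribution_eq_layer (hsupp : tsupport g ⊆ Icc (-b) b) :
    contribution q g = -(2 * Real.log q / Real.sqrt q *
      (∫ u in Icc (Real.log q - b) b, g u * conj (g (u - Real.log q))).re) := by
  rw [contribution_eq_two_mul, weilConv_weilReflect_eq_integral, integral_mul_conj_shift_eq_setIntegral hsupp]

/-- `Re ∫_{layer} ‖g‖²` bookkeeping: if the integrand equals `±‖g u‖²` on the layer. [folklore] -/
theorem re_setIntegral_of_eq_normSq {s : Set ℝ} (hs : MeasurableSet s) {F : ℝ → ℂ} (c : ℝ)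
    (hF : ∀ u ∈ s, F u = c * ((‖g u‖ ^ 2 : ℝ) : ℂ)) :
    (∫ u in s, F u).re = c * ∫ u in s, ‖g u‖ ^ 2 := by
  rw [setIntegral_congr_fun hs hF, integral_const_mul, integral_complex_ofReal, ← Complex.ofReal_mul, Complex.ofReal_re]

/-- **EVEN with a mirror-SYMMETRIC layer profile is charged in full**: `g` even on `[−b, b]` with `g(log q − u) = g(u)` for `u ∈ [log q − b, b]`
(e.g. the even Cramér pair of XII-k) has `contribution_q(g) = −(2 log q/√q)·∫_{[log q − b, b]} ‖g‖²`. [this track] -/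
theorem contribution_even_of_mirror_symmetric_layer (hsupp : tsupport g ⊆ Icc (-b) b) (hev : ∀ t, g (-t) = g t)
    (hsym : ∀ u ∈ Icc (Real.log q - b) b, g (Real.log q - u) = g u) :
    contribution q g = -(2 * Real.log q / Real.sqrt q * ∫ u in Icc (Real.log q - b) b, ‖g u‖ ^ 2) := by
  rw [contribution_eq_layer hsupp, re_setIntegral_of_eq_normSq measurableSet_Icc 1 fun u hu ↦ ?_, one_mul]
  rw [← hev (u - Real.log q), neg_sub, hsym u hu, Complex.mul_conj, Complex.normSq_eq_norm_sq, Complex.ofReal_one, one_mul]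

/-- **EVEN with a mirror-ANTISYMMETRIC layer profile (a node AT the entrance point, odd local profile) is rewarded in full**:
`g(log q − u) = −g(u)` on `[log q − b, b]` gives `contribution_q(g) = +(2 log q/√q)·∫_{[log q − b, b]} ‖g‖²` — the node law's extremal shape. [this track] -/
theorem contribution_even_of_mirror_antisymmetric_layer (hsupp : tsupport g ⊆ Icc (-b) b) (hev : ∀ t, g (-t) = g t)
    (hanti : ∀ u ∈ Icc (Real.log q - b) b, g (Real.log q - u) = -g u) :
    contribution q g = 2 * Real.log q / Real.sqrt q * ∫ u in Icc (Real.log q - b) b, ‖g u‖ ^ 2 := by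
  rw [contribution_eq_layer hsupp, re_setIntegral_of_eq_normSq measurableSet_Icc (-1) fun u hu ↦ ?_]
  · ring
  rw [← hev (u - Real.log q), neg_sub, hanti u hu, map_neg, mul_neg, Complex.mul_conj, Complex.normSq_eq_norm_sq, Complex.ofReal_neg,
    Complex.ofReal_one, neg_one_mul]

/-- **ODD with a mirror-SYMMETRIC layer profile is rescued in full**: `g` odd with `g(log q − u) = g(u)` on `[log q − b, b]` (single-signed,
symmetric about the entrance point — the shape of the certified odd wall vectors) has `contribution_q(g) = +(2 log q/√q)·∫_{[log q − b, b]} ‖g‖²`. [this track] -/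
theorem contribution_odd_of_mirror_symmetric_layer (hsupp : tsupport g ⊆ Icc (-b) b) (hodd : ∀ t, g (-t) = -g t)
    (hsym : ∀ u ∈ Icc (Real.log q - b) b, g (Real.log q - u) = g u) :
    contribution q g = 2 * Real.log q / Real.sqrt q * ∫ u in Icc (Real.log q - b) b, ‖g u‖ ^ 2 := by
  rw [contribution_eq_layer hsupp, re_setIntegral_of_eq_normSq measurableSet_Icc (-1) fun u hu ↦ ?_]
  · ring
  rw [← neg_sub (Real.log q) u, hodd (Real.log q - u), hsym u hu, map_neg, mul_neg, Complex.mul_conj, Complex.normSq_eq_norm_sq, Complex.ofReal_neg,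
    Complex.ofReal_one, neg_one_mul]

/-- **ODD with a mirror-ANTISYMMETRIC layer profile is charged in full**: `g(log q − u) = −g(u)` on the layer gives
`contribution_q(g) = −(2 log q/√q)·∫_{[log q − b, b]} ‖g‖²`. [this track] -/
theorem contribution_odd_of_mirror_antisymmetric_layer (hsupp : tsupport g ⊆ Icc (-b) b) (hodd : ∀ t, g (-t) = -g t)
    (hanti : ∀ u ∈ Icc (Real.log q - b) b, g (Real.log q - u) = -g u) :
    contribution q g = -(2 * Real.log q / Real.sqrt q * ∫ u in Icc (Real.log q - b) b, ‖g u‖ ^ 2) := by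
  rw [contribution_eq_layer hsupp, re_setIntegral_of_eq_normSq measurableSet_Icc 1 fun u hu ↦ ?_, one_mul]
  rw [← neg_sub (Real.log q) u, hodd (Real.log q - u), hanti u hu, neg_neg, Complex.mul_conj, Complex.normSq_eq_norm_sq, Complex.ofReal_one, one_mul]

/-! ## §5 (append, theory-2 gen7) Negative witnesses of the deleted form: which mirror part dominates

On the handoff window (`q < q'` consecutive, `b ≤ (log q')/2`, `tsupport g ⊆ [−b, b]`) the full form is `Re Q = contribution_q − deficit_q` with
`deficit_q = −Re Q_{S_q}` (`HandoffWindow`). So a NEGATIVE WITNESS of the deleted form (`Re Q_{S_q}(g) < 0`) under Weil positivity on `C(b)`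
(`0 ≤ Re Q(g)`, e.g. from `WeilPositivityOn b` or the certified sector energies) has `contribution_q(g) > 0`, and the polarization identities
say which mirror part of `g` about the entrance point must DOMINATE: the ANTISYMMETRIC one for even `g` (whence the node in the layer — XII-p),
the SYMMETRIC one for odd `g` (no node needed). -/

variable {q' : ℕ}

/-- A negative witness of the deleted form inside `q`'s window, at which Weil's form is non-negative, draws a POSITIVE contribution from `q`
(the missing prime would rescue it). [this track] -/
theorem contribution_pos_of_semilocal_neg (h : ConsecutivePrimes q q') (hg : IsWeilTest g) (hb : b ≤ Real.log q' / 2)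
    (hsupp : tsupport g ⊆ Icc (-b) b) (hQ : 0 ≤ (weilQuadratic g).re)
    (hneg : (weilSemilocalQuadratic (Nat.primesBelow q) g).re < 0) : 0 < contribution q g := by
  have hsupp' : tsupport g ⊆ Icc (-(Real.log q' / 2)) (Real.log q' / 2) := hsupp.trans (Icc_subset_Icc (neg_le_neg hb) hb)
  have hid := re_weilQuadratic_eq_contribution_sub_deficit h hg hsupp'
  unfold deficit at hid
  linarith

/-- **EVEN negative witnesses are predominantly mirror-ANTISYMMETRIC about the entrance point**: `‖g + g∘σ_L‖² < ‖g − g∘σ_L‖²`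
(`σ_L u = log q − u`), for an even negative witness of `Q_{S_q}` in `q`'s window at which Weil's form is `≥ 0`. [this track] -/
theorem normSq_add_mirror_lt_of_even_neg (h : ConsecutivePrimes q q') (hg : IsWeilTest g) (hb : b ≤ Real.log q' / 2)
    (hsupp : tsupport g ⊆ Icc (-b) b) (hev : ∀ t, g (-t) = g t) (hQ : 0 ≤ (weilQuadratic g).re)
    (hneg : (weilSemilocalQuadratic (Nat.primesBelow q) g).re < 0) :
    (∫ u : ℝ, ‖g u + g (Real.log q - u)‖ ^ 2) < ∫ u : ℝ, ‖g u - g (Real.log q - u)‖ ^ 2 := by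
  have hc := contribution_pos_of_semilocal_neg h hg hb hsupp hQ hneg
  rw [contribution_even_eq_mirror hg hev] at hc
  have hw := log_div_two_sqrt_nonneg q
  by_contra hle
  rw [not_lt] at hle
  have : Real.log q / (2 * Real.sqrt q) *
      ((∫ u : ℝ, ‖g u - g (Real.log q - u)‖ ^ 2) - ∫ u : ℝ, ‖g u + g (Real.log q - u)‖ ^ 2) ≤ 0 :=
    mul_nonpos_of_nonneg_of_nonpos hw (by linarith)
  linarith

/-- **ODD negative witnesses are predominantly mirror-SYMMETRIC about the entrance point**: `‖g − g∘σ_L‖² < ‖g + g∘σ_L‖²` for an odd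
negative witness of `Q_{S_q}` in `q`'s window at which Weil's form is `≥ 0` — no node is needed; this is the certified odd wall vectors' shape.
[this track] -/
theorem normSq_sub_mirror_lt_of_odd_neg (h : ConsecutivePrimes q q') (hg : IsWeilTest g) (hb : b ≤ Real.log q' / 2)
    (hsupp : tsupport g ⊆ Icc (-b) b) (hodd : ∀ t, g (-t) = -g t) (hQ : 0 ≤ (weilQuadratic g).re)
    (hneg : (weilSemilocalQuadratic (Nat.primesBelow q) g).re < 0) :
    (∫ u : ℝ, ‖g u - g (Real.log q - u)‖ ^ 2) < ∫ u : ℝ, ‖g u + g (Real.log q - u)‖ ^ 2 := by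
  have hc := contribution_pos_of_semilocal_neg h hg hb hsupp hQ hneg
  rw [contribution_odd_eq_mirror hg hodd] at hc
  have hw := log_div_two_sqrt_nonneg q
  by_contra hle
  rw [not_lt] at hle
  have : Real.log q / (2 * Real.sqrt q) *
      ((∫ u : ℝ, ‖g u + g (Real.log q - u)‖ ^ 2) - ∫ u : ℝ, ‖g u - g (Real.log q - u)‖ ^ 2) ≤ 0 :=
    mul_nonpos_of_nonneg_of_nonpos hw (by linarith)
  linarith

/-- The `WeilPositivityOn` packaging of the even case (the A1 input: a rung or a certified two-sector cell at `c ≥ b`). [this track] -/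
theorem normSq_add_mirror_lt_of_even_neg_of_weilPositivityOn (h : ConsecutivePrimes q q') (hg : IsWeilTest g)
    (hb : b ≤ Real.log q' / 2) (hsupp : tsupport g ⊆ Icc (-b) b) (hev : ∀ t, g (-t) = g t) (hW : WeilPositivityOn b)
    (hneg : (weilSemilocalQuadratic (Nat.primesBelow q) g).re < 0) :
    (∫ u : ℝ, ‖g u + g (Real.log q - u)‖ ^ 2) < ∫ u : ℝ, ‖g u - g (Real.log q - u)‖ ^ 2 :=
  normSq_add_mirror_lt_of_even_neg h hg hb hsupp hev (hW g hg hsupp) hneg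

end Summit.RiemannHypothesis.RiemannHypothesis.Theorems.HandoffMirrorPolarization

end
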